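import Literature.AlgebraicGeometry.Motives.EtaleInverseImageComp
import Literature.AlgebraicGeometry.Motives.ExtMapExactFunctor
import HarnessLib

/-!
# Functoriality of the pull-back on `R`-linear étale cohomology: `(g f)^* = f^* ∘ g^*`, `(𝟙)^* = id`

For morphisms of schemes `X —f→ Y —g→ Z` and a commutative ring `R`, the pull-backs
`etaleModCohomologyMap f R n : Hⁿ(Y_ét, R) →ₗ[R] Hⁿ(X_ét, R)` of `EtaleInverseImage.lean`
(multiplicative for the cup product, unital) satisfy

* `etaleModCohomologyMap_comp`: `(g ∘ f)^* = f^* ∘ g^*`;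
* `etaleModCohomologyMap_id`: `(𝟙_X)^* = id`;

so that `X ↦ H•(X_ét, R)` is a contravariant functor to graded `R`-algebras (Milne III Rem. 1.6 (c):
"`Hⁱ(X_E, F)` is a contravariant functor on `X_E`"; II Rem. 3.1 (f): `π^* π'^* = (π'π)^*`). The
proofs are short: `Ext.mapExactFunctor_functorComp` / `_functorIso` / `_functorId`
(`ExtMapExactFunctor.lean`) reduce them to the coherences of `(g f)^* ≅ f^* g^*`, `(𝟙)^* ≅ 𝟭` with
the constant-sheaf isomorphisms (`EtaleInverseImageComp.lean`). The sheaf-level statements with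
general coefficient sheaves (`linearCohomologyPullback_linearCohomologyPullback`,
`linearCohomologyPullback_id`) are included.

## References

* J. S. Milne, *Étale cohomology* (reissue 2025; held copy): II Rem. 3.1 (f) p. 77, III Rem.
  1.6 (c) p. 95. [Milne2025]
-/

universe u

open CategoryTheory CategoryTheory.Limits AlgebraicGeometry Opposite CategoryTheory.Abelian

namespace Literature.AlgebraicGeometry.Motives

variable {X Y Z : Scheme.{u}} (f : X ⟶ Y) (g : Y ⟶ Z) (R : Type u) [CommRing R]

/-! ### Composition -/

section Comp

/-- The composite `f^* ∘ g^*` of inverse images of sheaves of `R`-modules is additive. [folklore] -/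
instance etaleInverseImage_comp_additive :
    (etaleInverseImage g (ModuleCat.{u} R) ⋙ etaleInverseImage f (ModuleCat.{u} R)).Additive :=
  inferInstance

/-- The composite `f^* ∘ g^*` is left exact. [folklore] -/
instance etaleInverseImage_comp_preservesFiniteLimits :
    PreservesFiniteLimits
      (etaleInverseImage g (ModuleCat.{u} R) ⋙ etaleInverseImage f (ModuleCat.{u} R)) :=
  comp_preservesFiniteLimits _ _

/-- The composite `f^* ∘ g^*` is right exact. [folklore] -/
instance etaleInverseImage_comp_preservesFiniteColimits :
    PreservesFiniteColimits
      (etaleInverseImage g (ModuleCat.{u} R) ⋙ etaleInverseImage f (ModuleCat.{u} R)) :=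
  comp_preservesFiniteColimits _ _

set_option backward.isDefEq.respectTransparency false in
/-- `(ι_f)⁻¹ ≫ f^*((ι_g)⁻¹) ≫ c = (ι_{gf})⁻¹` on `M`: the inverse form of
`etaleInverseImageComp_inv_app_comp_constantSheafIso`. [folklore] -/
theorem inverseImageConstantSheafIso_inv_comp_map_inv (M : ModuleCat.{u} R) :
    (etaleInverseImageConstantSheafIso f (ModuleCat.{u} R) M).inv ≫
        (etaleInverseImage f (ModuleCat.{u} R)).map
          (etaleInverseImageConstantSheafIso g (ModuleCat.{u} R) M).inv ≫
        (etaleInverseImageComp f (ModuleCat.{u} R) g).hom.app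
          ((constantSheaf Z.smallEtaleTopology (ModuleCat.{u} R)).obj M) =
      (etaleInverseImageConstantSheafIso (f ≫ g) (ModuleCat.{u} R) M).inv := by
  have K := etaleInverseImageComp_inv_app_comp_constantSheafIso f (ModuleCat.{u} R) g M
  rw [← cancel_epi (etaleInverseImageConstantSheafIso (f ≫ g) (ModuleCat.{u} R) M).hom,
    Iso.hom_inv_id, ← K]
  simp only [Category.assoc, Iso.hom_inv_id_assoc]
  rw [← Functor.map_comp_assoc, Iso.hom_inv_id, CategoryTheory.Functor.map_id, Category.id_comp]
  exact Iso.inv_hom_id_app _ _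

set_option backward.isDefEq.respectTransparency false in
/-- **Transitivity of the pull-back on `R`-linear étale cohomology with sheaf coefficients**:
`f^*(g^*(x)) = (gf)^*(x)` in `Hⁿ(X_ét, f^* g^* F)` after `(gf)^* F ≅ f^* g^* F`
(Milne III Rem. 1.6 (c), II Rem. 3.1 (f)). [cite: Milne2025, III Remark 1.6 (c)] -/
theorem linearCohomologyPullback_linearCohomologyPullback
    (F : Sheaf Z.smallEtaleTopology (ModuleCat.{u} R)) (n : ℕ) (x : linearCohomology R F n) :
    linearCohomologyPullback f R _ n (linearCohomologyPullback g R F n x) =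
      linearCohomology.map ((etaleInverseImageComp f (ModuleCat.{u} R) g).inv.app F) n
        (linearCohomologyPullback (f ≫ g) R F n x) := by
  rw [linearCohomologyPullback_apply, linearCohomologyPullback_apply, linearCohomologyPullback_apply,
    linearCohomology.map_apply, Ext.mapExactFunctor_comp, Ext.mapExactFunctor_mk₀,
    ← Ext.mapExactFunctor_functorComp, ← Ext.comp_assoc_of_second_deg_zero, Ext.mk₀_comp_mk₀,
    ← Ext.mapExactFunctor_functorIso (etaleInverseImageComp f (ModuleCat.{u} R) g).symm x,
    Iso.symm_inv, Iso.symm_hom, ← Ext.comp_assoc_of_second_deg_zero, Ext.mk₀_comp_mk₀,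
    Category.assoc, inverseImageConstantSheafIso_inv_comp_map_inv,
    Ext.comp_assoc_of_third_deg_zero]

set_option backward.isDefEq.respectTransparency false in
/-- **`(g ∘ f)^* = f^* ∘ g^*` on `Hⁿ(–_ét, R)`** (Milne III Rem. 1.6 (c): "`Hⁱ(X_E, F)` is a
contravariant functor"; with `etaleModCohomologyMap_cup`/`_one` of `EtaleInverseImage.lean`,
`X ↦ H•(X_ét, R)` is a functor to graded `R`-algebras). [cite: Milne2025, III Remark 1.6 (c)] -/
theorem etaleModCohomologyMap_comp (n : ℕ) (x : etaleModCohomology Z R n) :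
    etaleModCohomologyMap (f ≫ g) R n x =
      etaleModCohomologyMap f R n (etaleModCohomologyMap g R n x) := by
  have K := etaleInverseImageComp_inv_app_comp_constantSheafIso f (ModuleCat.{u} R) g
    (ModuleCat.of R R)
  symm
  calc etaleModCohomologyMap f R n (etaleModCohomologyMap g R n x)
      = linearCohomology.map (etaleInverseImageConstantSheafIso f (ModuleCat.{u} R) (.of R R)).hom n
          (linearCohomologyPullback f R _ n
            (linearCohomology.map (etaleInverseImageConstantSheafIso g (ModuleCat.{u} R)
              (.of R R)).hom n (linearCohomologyPullback g R _ n x))) := rfl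
    _ = linearCohomology.map (etaleInverseImageConstantSheafIso f (ModuleCat.{u} R) (.of R R)).hom n
          (linearCohomology.map ((etaleInverseImage f (ModuleCat.{u} R)).map
            (etaleInverseImageConstantSheafIso g (ModuleCat.{u} R) (.of R R)).hom) n
            (linearCohomologyPullback f R _ n (linearCohomologyPullback g R _ n x))) := by
        rw [linearCohomologyPullback_map]
    _ = linearCohomology.map (etaleInverseImageConstantSheafIso f (ModuleCat.{u} R) (.of R R)).hom n
          (linearCohomology.map ((etaleInverseImage f (ModuleCat.{u} R)).map
            (etaleInverseImageConstantSheafIso g (ModuleCat.{u} R) (.of R R)).hom) n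
            (linearCohomology.map ((etaleInverseImageComp f (ModuleCat.{u} R) g).inv.app _) n
              (linearCohomologyPullback (f ≫ g) R _ n x))) := by
        rw [linearCohomologyPullback_linearCohomologyPullback]
    _ = linearCohomology.map ((etaleInverseImageComp f (ModuleCat.{u} R) g).inv.app _ ≫
          (etaleInverseImage f (ModuleCat.{u} R)).map
            (etaleInverseImageConstantSheafIso g (ModuleCat.{u} R) (.of R R)).hom ≫
          (etaleInverseImageConstantSheafIso f (ModuleCat.{u} R) (.of R R)).hom) n
          (linearCohomologyPullback (f ≫ g) R _ n x) := by
        rw [linearCohomology.map_comp, linearCohomology.map_comp]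
        rfl
    _ = etaleModCohomologyMap (f ≫ g) R n x := by
        rw [K]
        rfl

end Comp

/-! ### Identity -/

section Id

/-- The identity functor of `Sh(X_et, R)` is additive. [folklore] -/
instance id_sheaf_additive : (𝟭 (Sheaf X.smallEtaleTopology (ModuleCat.{u} R))).Additive :=
  inferInstance

/-- The identity functor is left exact. [folklore] -/
instance id_sheaf_preservesFiniteLimits :
    PreservesFiniteLimits (𝟭 (Sheaf X.smallEtaleTopology (ModuleCat.{u} R))) :=
  inferInstance

/-- The identity functor is right exact. [folklore] -/
instance id_sheaf_preservesFiniteColimits :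
    PreservesFiniteColimits (𝟭 (Sheaf X.smallEtaleTopology (ModuleCat.{u} R))) :=
  inferInstance

set_option backward.isDefEq.respectTransparency false in
/-- **The pull-back along `𝟙_X` is the identity up to `(𝟙)^* F ≅ F`** on `R`-linear étale
cohomology with sheaf coefficients. [cite: Milne2025, III Remark 1.6 (c)] -/
theorem linearCohomologyPullback_id (F : Sheaf X.smallEtaleTopology (ModuleCat.{u} R)) (n : ℕ)
    (x : linearCohomology R F n) :
    linearCohomology.map ((etaleInverseImageId X (ModuleCat.{u} R)).hom.app F) n
        (linearCohomologyPullback (𝟙 X) R F n x) = x := by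
  have h := Ext.mapExactFunctor_functorIso (etaleInverseImageId X (ModuleCat.{u} R)) x
  rw [Ext.mapExactFunctor_functorId] at h
  have hι : (etaleInverseImageSelfIso (𝟙 X) R).inv =
      (etaleInverseImageId X (ModuleCat.{u} R)).inv.app (constantSheafSelf X.smallEtaleTopology R) := by
    rw [← Iso.app_inv, Iso.inv_eq_inv]
    exact (etaleInverseImageId_hom_app_constantSheaf X (ModuleCat.{u} R) (ModuleCat.of R R)).symm
  rw [linearCohomologyPullback_apply, linearCohomology.map_apply, Ext.comp_assoc_of_third_deg_zero,
    hι]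
  exact h

set_option backward.isDefEq.respectTransparency false in
/-- **`(𝟙_X)^* = id` on `Hⁿ(X_ét, R)`.** [cite: Milne2025, III Remark 1.6 (c)] -/
theorem etaleModCohomologyMap_id (n : ℕ) (x : etaleModCohomology X R n) :
    etaleModCohomologyMap (𝟙 X) R n x = x := by
  rw [etaleModCohomologyMap, linearCohomologyMap_apply,
    ← etaleInverseImageId_hom_app_constantSheaf]
  exact linearCohomologyPullback_id R _ n x

end Id

end Literature.AlgebraicGeometry.Motives
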